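import Literature.NumberTheory.Sieve.PolymathSieveAsymptotics
import HarnessLib

/-!
# `λ_F` on square-free integers with prime factors in prescribed short ranges

Trunk AntSieve, tooling toward the named fact `Literature.NumberTheory.Sieve.weakDHL_three_two_of_GEH`
(D. H. J. Polymath, Res. Math. Sci. 1:12 (2014) = arXiv:1407.4897, Theorem 3.2(xii)).  In the proof of
Theorem 3.6(ii) (§4.5, p. 17): "for `n` in `A_{j_1,…,j_r}`, the `2^r` factors of `n` are just the
products of subsets of `{p_1,…,p_r}`, and from the smoothness of `F_k, G_k` we see that `λ_{F_k}(n)` is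
equal to some bounded constant (depending on `j_1,…,j_r` but independent of `p_1,…,p_r`), plus an error
of `O(log^{-A} x)`".  Here:

* `divisorSumWeight_eq_sum_powerset` — for square-free `n`,
  `λ_F(n) = Σ_{S ⊆ primeFactors n} (−1)^{#S} F(Σ_{p ∈ S} log_x p)`;
* `lambdaModel F u n = Σ_{S ⊆ primeFactors n} (−1)^{#S} F(Σ_{p ∈ S} u p)` — the "constant", for any
  assignment `u` of model values to the primes (in §4.5, `u p = log_x N_j` for `p ∈ I_j`);
* `abs_divisorSumWeight_sub_lambdaModel_le` — if `|F'| ≤ D` and `|log_x p − u p| ≤ η` for the prime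
  factors of `n`, then `|λ_F(n) − lambdaModel F u n| ≤ 2^{ω(n)} D ω(n) η` (mean value theorem).

## References

* [Polymath8b2014] D. H. J. Polymath, Res. Math. Sci. 1 (2014), Art. 12 = arXiv:1407.4897,
  §4.5, p. 17.
-/

noncomputable section

open Finset Real
open scoped ArithmeticFunction.Moebius ArithmeticFunction.omega

namespace Literature.NumberTheory.Sieve

/-! ### Divisors of a square-free number as subsets of its prime factors -/

/-- For square-free `n`, `S ↦ ∏_{p ∈ S} p` is a bijection from the subsets of the prime factors onto the
divisors, and `μ(∏ S) = (−1)^{#S}`; hence any divisor sum reindexes over the power set. [folklore] -/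
theorem sum_divisors_eq_sum_powerset_of_squarefree {n : ℕ} (hn : Squarefree n) (g : ℕ → ℝ) :
    ∑ d ∈ n.divisors, (μ d : ℝ) * g d =
      ∑ S ∈ n.primeFactors.powerset, (-1 : ℝ) ^ #S * g (∏ p ∈ S, p) := by
  have hn0 : n ≠ 0 := hn.ne_zero
  -- the map and its properties
  have hprime : ∀ S ∈ n.primeFactors.powerset, ∀ p ∈ S, p.Prime := fun S hS p hp =>
    Nat.prime_of_mem_primeFactors (Finset.mem_powerset.1 hS hp)
  have hdvd : ∀ S ∈ n.primeFactors.powerset, (∏ p ∈ S, p) ∣ n := fun S hS =>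
    (Finset.prod_dvd_prod_of_subset _ _ _ (Finset.mem_powerset.1 hS)).trans (Nat.prod_primeFactors_dvd n)
  have hsqf : ∀ S ∈ n.primeFactors.powerset, Squarefree (∏ p ∈ S, p) := fun S hS =>
    Squarefree.squarefree_of_dvd (hdvd S hS) hn
  have hpf : ∀ S ∈ n.primeFactors.powerset, (∏ p ∈ S, p).primeFactors = S := fun S hS =>
    Nat.primeFactors_prod (hprime S hS)
  symm
  refine Finset.sum_bij (fun S _ => ∏ p ∈ S, p) (fun S hS => Nat.mem_divisors.2 ⟨hdvd S hS, hn0⟩) ?_ ?_ ?_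
  · -- injective
    intro S hS S' hS' h
    have := congrArg Nat.primeFactors h
    rwa [hpf S hS, hpf S' hS'] at this
  · -- surjective
    intro d hd
    rw [Nat.mem_divisors] at hd
    refine ⟨d.primeFactors, Finset.mem_powerset.2 (Nat.primeFactors_mono hd.1 hn0), ?_⟩
    exact Nat.prod_primeFactors_of_squarefree (Squarefree.squarefree_of_dvd hd.1 hn)
  · -- values: `μ(∏ S) = (−1)^{Ω(∏ S)} = (−1)^{#S}`
    intro S hS
    have hne : (∏ p ∈ S, p) ≠ 0 := Finset.prod_ne_zero_iff.2 fun p hp => (hprime S hS p hp).ne_zero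
    have hΩ : ArithmeticFunction.cardFactors (∏ p ∈ S, p) = #S := by
      rw [ArithmeticFunction.cardFactors_apply,
        ← List.toFinset_card_of_nodup ((Nat.squarefree_iff_nodup_primeFactorsList hne).1 (hsqf S hS)),
        Nat.toFinset_factors, hpf S hS]
    rw [ArithmeticFunction.moebius_apply_of_squarefree (hsqf S hS), hΩ]
    push_cast
    rfl

/-- **`λ_F` on square-free numbers**: `λ_F(n) = Σ_{S ⊆ primeFactors n} (−1)^{#S} F((Σ_{p∈S} log p)/log x)`.
[cite: Polymath8b2014, §4.5, p. 17] -/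
theorem divisorSumWeight_eq_sum_powerset (F : ℝ → ℝ) (x : ℝ) {n : ℕ} (hn : Squarefree n) :
    divisorSumWeight F x n =
      ∑ S ∈ n.primeFactors.powerset, (-1 : ℝ) ^ #S * F ((∑ p ∈ S, Real.log p) / Real.log x) := by
  rw [divisorSumWeight, sum_divisors_eq_sum_powerset_of_squarefree hn]
  refine Finset.sum_congr rfl fun S hS => ?_
  congr 2
  push_cast
  rw [Real.log_prod]
  intro p hp
  exact_mod_cast (Nat.prime_of_mem_primeFactors (Finset.mem_powerset.1 hS hp)).ne_zero

/-! ### The model value and the comparison -/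

/-- The model value of `λ_F(n)` when each prime factor `p` is assigned the model logarithm `u p`:
`Σ_{S ⊆ primeFactors n} (−1)^{#S} F(Σ_{p ∈ S} u p)` (the "bounded constant depending on `j_1,…,j_r`"
of §4.5). [cite: Polymath8b2014, §4.5, p. 17] -/
def lambdaModel (F : ℝ → ℝ) (u : ℕ → ℝ) (n : ℕ) : ℝ :=
  ∑ S ∈ n.primeFactors.powerset, (-1 : ℝ) ^ #S * F (∑ p ∈ S, u p)

/-- `|lambdaModel F u n| ≤ 2^{ω(n)} sup |F|`. [folklore] -/
theorem abs_lambdaModel_le {F : ℝ → ℝ} {M : ℝ} (hM : ∀ t, |F t| ≤ M) (u : ℕ → ℝ) (n : ℕ) :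
    |lambdaModel F u n| ≤ 2 ^ n.primeFactors.card * M := by
  unfold lambdaModel
  refine (Finset.abs_sum_le_sum_abs _ _).trans ?_
  calc ∑ S ∈ n.primeFactors.powerset, |(-1 : ℝ) ^ #S * F (∑ p ∈ S, u p)|
      ≤ ∑ _S ∈ n.primeFactors.powerset, M := Finset.sum_le_sum fun S _ => by
        rw [abs_mul, abs_pow, abs_neg, abs_one, one_pow, one_mul]; exact hM _
    _ = 2 ^ n.primeFactors.card * M := by rw [Finset.sum_const, Finset.card_powerset, nsmul_eq_mul]; push_cast; ring

/-- **`λ_F` is nearly constant on products of primes from fixed short ranges**: if `F` is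
differentiable with `|F'| ≤ D`, `n` is square-free and `|log p / log x − u p| ≤ η` for every prime
factor `p` of `n`, then `|λ_F(n) − lambdaModel F u n| ≤ 2^{ω(n)} D ω(n) η`.
[cite: Polymath8b2014, §4.5, p. 17] -/
theorem abs_divisorSumWeight_sub_lambdaModel_le {F : ℝ → ℝ} (hF : Differentiable ℝ F) {D : ℝ}
    (hD : ∀ t, |deriv F t| ≤ D) (x : ℝ) {n : ℕ} (hn : Squarefree n) (u : ℕ → ℝ) {η : ℝ}
    (hu : ∀ p ∈ n.primeFactors, |Real.log p / Real.log x - u p| ≤ η) :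
    |divisorSumWeight F x n - lambdaModel F u n| ≤
      2 ^ n.primeFactors.card * (D * (n.primeFactors.card * η)) := by
  rw [divisorSumWeight_eq_sum_powerset F x hn, lambdaModel, ← Finset.sum_sub_distrib]
  refine (Finset.abs_sum_le_sum_abs _ _).trans ?_
  -- each term: mean value theorem and `|Σ_{p∈S} (log_x p − u p)| ≤ #S η`
  have hterm : ∀ S ∈ n.primeFactors.powerset,
      |(-1 : ℝ) ^ #S * F ((∑ p ∈ S, Real.log p) / Real.log x) - (-1 : ℝ) ^ #S * F (∑ p ∈ S, u p)| ≤
        D * (#S * η) := by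
    intro S hS
    have hSsub := Finset.mem_powerset.1 hS
    rw [← mul_sub, abs_mul, abs_pow, abs_neg, abs_one, one_pow, one_mul]
    have hmvt := Convex.norm_image_sub_le_of_norm_deriv_le (f := F) (s := Set.univ) (C := D)
      (fun t _ => hF t) (fun t _ => by rw [Real.norm_eq_abs]; exact hD t) convex_univ
      (Set.mem_univ (∑ p ∈ S, u p)) (Set.mem_univ ((∑ p ∈ S, Real.log p) / Real.log x))
    rw [Real.norm_eq_abs, Real.norm_eq_abs] at hmvt
    refine hmvt.trans (mul_le_mul_of_nonneg_left ?_ ((abs_nonneg _).trans (hD 0)))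
    rw [Finset.sum_div, ← Finset.sum_sub_distrib]
    refine (Finset.abs_sum_le_sum_abs _ _).trans ?_
    calc ∑ p ∈ S, |Real.log p / Real.log x - u p| ≤ ∑ _p ∈ S, η :=
          Finset.sum_le_sum fun p hp => hu p (hSsub hp)
      _ = #S * η := by rw [Finset.sum_const, nsmul_eq_mul]
  refine (Finset.sum_le_sum hterm).trans ?_
  -- `Σ_S D #S η ≤ 2^ω D ω η`
  rcases n.primeFactors.eq_empty_or_nonempty with h0 | ⟨p₀, hp₀⟩
  · rw [h0]; simp
  · have hη : 0 ≤ η := (abs_nonneg _).trans (hu p₀ hp₀)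
    have hD0 : 0 ≤ D := (abs_nonneg _).trans (hD 0)
    calc ∑ S ∈ n.primeFactors.powerset, D * (#S * η)
        ≤ ∑ _S ∈ n.primeFactors.powerset, D * (n.primeFactors.card * η) := by
          refine Finset.sum_le_sum fun S hS => mul_le_mul_of_nonneg_left ?_ hD0
          exact mul_le_mul_of_nonneg_right (by exact_mod_cast Finset.card_le_card (Finset.mem_powerset.1 hS)) hη
      _ = 2 ^ n.primeFactors.card * (D * (n.primeFactors.card * η)) := by
          rw [Finset.sum_const, Finset.card_powerset, nsmul_eq_mul]; push_cast; ring

end Literature.NumberTheory.Sieve
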